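import Summits.BirchSwinnertonDyer.BirchSwinnertonDyer.Theorems.ManinLocalTwoThreePinningTwoFiftyTwo
import Summits.BirchSwinnertonDyer.BirchSwinnertonDyer.Theorems.ManinLocalTwoThreeRootFormsEightyFour
import Summits.BirchSwinnertonDyer.BirchSwinnertonDyer.Theorems.ManinLocalTwoThreeOddTwistRootFormTransport
import Summits.BirchSwinnertonDyer.BirchSwinnertonDyer.Theorems.EisensteinPrimesMazurMCOnCellBTwistbackShaUnitClassP3Atlas002
import Summits.BirchSwinnertonDyer.BirchSwinnertonDyer.Theorems.Rank1ResidualIntModelReduction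
import Literature.NumberTheory.EllipticCurves.CuspFormTwist
import Literature.NumberTheory.EllipticCurves.RootNumberTwistProofs
import HarnessLib

/-!
# LEVEL 252 = 2²·3²·7 COMPLETE — in BOTH crux domains (`4 ∣ 252`, `9 ∣ 252`): `|c| = 1`, hence `2 ∤ c` and `3 ∤ c`, for EVERY lattice-optimal
# `X₀(252)`-datum of every globally minimal elliptic curve over `ℚ`, UNCONDITIONALLY

Cell `bsd-f2-manin`, route `ManinLocalTwoThree`, cruxes C2 `ManinOddAtFour` (stmt-BirchSwinnertonDyer-22967) AND C3 `ManinPrimeToThreeAtNine` (stmt-…-22968);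
prover seat p2 gen 32 (`--supports`, helper).  The two classes of conductor `252` are `252a = 84a ⊗ χ₋₃`, `252b = 84b ⊗ χ₋₃` (LEAD-MEMO v44 §8).  ASSEMBLY:
* §1 ROWS: an g57's FACT-FREE kernel pinning in `S₂(Γ₀(252))` (`PinningTwoFiftyTwo.pinning_cusp`, `37` cuspidal `η`-quotients, duals `d = 1728` on `n < 192`,
  two rows `rowA`/`rowB`, both `d′ = 1`) + the twisted tables `tabTA/B[n] = (n/3)·aₙ(84a1/84b1)` + two `decide` row identities ⇒ by the row lemma
  `PinningKernelRows.eq_of_smul_eq_sum_of_row` in `V = S₂(Γ₀(252))`: **`D.f = φ₈₄ₐ ⊗ χ₋₃` or `D.f = φ₈₄ᵦ ⊗ χ₋₃`** (`CuspFormTwist.charTwist`), the roots being the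
  DATUM-FREE terms of `…RootFormsEightyFour` (p2 gen 32; squeezes `Λ(φ₈₄ₓ) ⊆ Λ_Néron(84x1)` from p2 gen 31's Bracket–Sturm certificates of level `84`).
* §2 ROOT CURVES: `84a1 = [0,1,0,7,0]` and `84b1 = [0,−1,0,−1,−2]` are multiplicative at `3` (`3 ∥ 84`; tree lemma `…Atlas002.mult_84a1`, and `mult_84b1` here).
* §3 HEADLINE by p3's odd-twist ROOT-FORM TRANSPORT at `p = 3` (`abs_maninConstant_eq_one_of_rootForm_charTwist_eq`: Stevens (5.2) PROVED + `Γ₀` twisting +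
  Néron squeeze): **`abs_maninConstant_eq_one_twoFiftyTwo`**, `not_two_dvd_…`, `not_three_dvd_…`, **`maninOddAtFour_twoFiftyTwo`**, **`maninPrimeToThreeAtNine_twoFiftyTwo`**.
HONEST FRAMING: unconditional (standard axioms) — no modularity input, no CDT, no printed Manin fact, no Cremona table as axiom; ONE level of the C2 and C3
domains — nothing here proves C2 or C3 for all `N`, Manin's conjecture or BSD; items 22967/22968 stay OPEN.
[cite: Stevens1989, Lemma (5.2) p. 96, Lemma (5.4) p. 97] [cite: AgasheRibetStein2006, §§1–2] [cite: Shimura1971, Prop. 3.64]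
[cite: CremonaAlgorithms1997, §2.10, Table 1 (84a1, 84b1), Table 1 (N = 252)] [cite: SilvermanAEC2009, VII.5 Prop. 5.1(b)]
-/

set_option autoImplicit false
-- lint-debt: the directory name repeats the summit name (sibling precedent `ManinLocalTwoThreeManinConstantTwoHundredC.lean`)
set_option linter.dupNamespace false

noncomputable section

open Complex
open UpperHalfPlane hiding I
open scoped MatrixGroups ModularForm
open ModularForm CongruenceSubgroup PowerSeries
open Literature.NumberTheory.ModularForms
open Literature.NumberTheory.EllipticCurves Literature.NumberTheory.EllipticCurves.ModularForms

namespace Summit.BirchSwinnertonDyer.BirchSwinnertonDyer.Theorems.ManinLocalTwoThree.LevelTwoFiftyTwo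

open Summit.BirchSwinnertonDyer.BirchSwinnertonDyer.Theorems.ManinLocalTwoThree
open Summit.BirchSwinnertonDyer.BirchSwinnertonDyer.Rank1Residual.IntModel
open BracketSturm PinningKernel PinningTwoFiftyTwo RootFormsEightyFour OddTwistRootForm

set_option maxHeartbeats 4000000
set_option maxRecDepth 16384

variable {W : WeierstrassCurve ℚ} [W.IsElliptic]

/-! ## §1 The rows: `D.f = φ₈₄ₓ ⊗ χ₋₃` -/

/-- The pinning row of `252a` (`= 84a ⊗ χ₋₃`): `(p, a_p)` signature, denominator, coordinates on an's cuspidal basis — literally an entry of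
`PinningTwoFiftyTwo.goodCerts`. [cite: CremonaAlgorithms1997, Table 1 (N = 252)] -/
def rowA : List (ℕ × ℤ) × ℤ × List ℤ :=
  ([(2, 0), (3, 0), (5, 0), (7, 1), (13, 2), (11, 6), (17, 0)], 1, [0, 0, 1, 1, 2, 4, 1, 1, 0, 0, -1, -1, 0, 0, 0, 0, 0, 0, 0, 0, 1, 1, 0, 0, 0, 0, -1, -2, 0, 0, 0, 0, 0, 0, 2, -1, 0])

/-- The twisted table `tabTA[n] = χ₋₃(n)·aₙ(84a1)`, `n < 192`. [folklore] -/
def tabTA : List ℤ :=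
  [0, 1, 0, 0, 0, 0, 0, 1, 0, 0, 0, 6, 0, 2, 0, 0, 0, 0, 0, -4, 0, 0, 0, 6, 0, -5, 0, 0, 0, -6, 0, 8, 0, 0, 0, 0, 0, 2, 0, 0, 0, -12, 0, -4, 0, 0, 0, -12, 0, 1, 0, 0, 0, 6, 0, 0, 0, 0, 0, 0,
   0, -10, 0, 0, 0, 0, 0, 8, 0, 0, 0, -6, 0, -10, 0, 0, 0, 6, 0, -4, 0, 0, 0, 12, 0, 0, 0, 0, 0, -12, 0, 2, 0, 0, 0, 0, 0, -10, 0, 0, 0, 12, 0, 8, 0, 0, 0, 6, 0, 14, 0, 0, 0, 6, 0, 0, 0, 0,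
   0, 0, 0, 25, 0, 0, 0, 0, 0, -4, 0, 0, 0, -12, 0, -4, 0, 0, 0, -6, 0, -4, 0, 0, 0, 12, 0, 0, 0, 0, 0, 6, 0, 8, 0, 0, 0, 0, 0, 14, 0, 0, 0, 6, 0, -16, 0, 0, 0, 12, 0, -9, 0, 0, 0, 12, 0,
   -5, 0, 0, 0, -6, 0, 2, 0, 0, 0, 0, 0, 0, 0, 0, 0, -6]

/-- The twist identity `tabTA[n] = (n/3)·cFA[n]`, `n < 192` (kernel `decide`). [folklore] -/
theorem hTwA : ∀ n < 192, tabTA.getD n 0 = legendreSym 3 n * LevelEightyFour.cFA.getD n 0 := by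
  decide +kernel

/-- Row identity, chunk `n < 96` (kernel `decide`). [folklore] -/
theorem hrowTA_0 : ∀ n, 0 ≤ n → n < 96 → rowA.2.1 * tabTA.getD n 0 = ∑ j : Fin 37, rowA.2.2.getD (j : ℕ) 0 * (tabs j).getD n 0 := by
  decide +kernel

/-- Row identity, chunk `96 ≤ n < 192` (kernel `decide`). [folklore] -/
theorem hrowTA_1 : ∀ n, 96 ≤ n → n < 192 → rowA.2.1 * tabTA.getD n 0 = ∑ j : Fin 37, rowA.2.2.getD (j : ℕ) 0 * (tabs j).getD n 0 := by
  decide +kernel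

/-- **Row identity**: `d′·tabTA[n] = Σ_j y_j·tabs_j[n]`, `n < 192` — the kernel's pinned combination on this row IS the `χ₋₃`-twist of `φ₈₄ₐ`
on the certified window. [folklore] -/
theorem hrowTA : ∀ n < 192, rowA.2.1 * tabTA.getD n 0 = ∑ j : Fin 37, rowA.2.2.getD (j : ℕ) 0 * (tabs j).getD n 0 := by
  intro n hn
  by_cases h0 : n < 96
  · exact hrowTA_0 n (by omega) h0
  · exact hrowTA_1 n (by omega) hn

/-- **`aₙ(φ₈₄ₐ ⊗ χ₋₃) = tabTA[n]`, `n < 192`**, read by the coefficient functionals of `S₂(Γ₀(252))`. [cite: Shimura1971, Prop. 3.64] -/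
theorem tabTA_eq_cuspCoeff [Fact (Nat.Prime 3)] : ∀ n < 192, ((tabTA.getD n 0 : ℤ) : ℂ) = cuspCoeffₗ (one_mem_strictPeriods_coe_gamma0 252) n
    (charTwist 252 (⟨3, rfl⟩ : 84 ∣ 252) (⟨28, rfl⟩ : 3 ^ 2 ∣ 252) (isQuadratic_quadraticChar_ringHomComp 3) phiEightyFourA) := by
  intro n hn
  have hc : ((tabTA.getD n 0 : ℤ) : ℂ) = ((legendreSym 3 n : ℤ) : ℂ) * ((LevelEightyFour.cFA.getD n 0 : ℤ) : ℂ) := by exact_mod_cast hTwA n hn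
  rw [cuspCoeffₗ_apply, cuspCoeff_charTwist 252 _ _ (isQuadratic_quadraticChar_ringHomComp 3)
    (isPrimitive_quadraticChar_ringHomComp 3 (by norm_num)), quadraticChar_ringHomComp_apply_natCast, ← tA_eq_cuspCoeff n (by omega)]
  exact hc

/-- The pinning row of `252b` (`= 84b ⊗ χ₋₃`): `(p, a_p)` signature, denominator, coordinates on an's cuspidal basis — literally an entry of
`PinningTwoFiftyTwo.goodCerts`. [cite: CremonaAlgorithms1997, Table 1 (N = 252)] -/
def rowB : List (ℕ × ℤ) × ℤ × List ℤ :=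
  ([(2, 0), (3, 0), (5, -4), (7, -1), (13, -6), (11, -2), (17, 4)], 1, [0, 0, -1, 1, 0, 0, 1, -1, 7, -14, 1, -1, -3, 12, 0, 0, 2, -2, 6, -6, -7, 7, 0, 0, 1, -7, 0, 0, -4, 2, 0, 0, 0, 0, 0, 0, 0])

/-- The twisted table `tabTB[n] = χ₋₃(n)·aₙ(84b1)`, `n < 192`. [folklore] -/
def tabTB : List ℤ :=
  [0, 1, 0, 0, 0, -4, 0, -1, 0, 0, 0, -2, 0, -6, 0, 0, 0, 4, 0, -4, 0, 0, 0, -2, 0, 11, 0, 0, 0, 2, 0, 0, 0, 0, 0, 4, 0, 2, 0, 0, 0, 0, 0, -4, 0, 0, 0, -12, 0, 1, 0, 0, 0, 6, 0, 8, 0, 0, 0,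
   8, 0, 6, 0, 0, 0, 24, 0, -8, 0, 0, 0, -14, 0, -2, 0, 0, 0, 2, 0, 12, 0, 0, 0, 4, 0, -16, 0, 0, 0, 0, 0, 6, 0, 0, 0, 16, 0, -2, 0, 0, 0, -16, 0, -16, 0, 0, 0, -18, 0, -2, 0, 0, 0, -10, 0,
   8, 0, 0, 0, -4, 0, -7, 0, 0, 0, -24, 0, 12, 0, 0, 0, -4, 0, 4, 0, 0, 0, 2, 0, 4, 0, 0, 0, 12, 0, -8, 0, 0, 0, 6, 0, -8, 0, 0, 0, 0, 0, 14, 0, 0, 0, 2, 0, -16, 0, 0, 0, -4, 0, 23, 0, 0,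
   0, -16, 0, -11, 0, 0, 0, 18, 0, -6, 0, 0, 0, -8, 0, -8, 0, 0, 0, 18]

/-- The twist identity `tabTB[n] = (n/3)·cFB[n]`, `n < 192` (kernel `decide`). [folklore] -/
theorem hTwB : ∀ n < 192, tabTB.getD n 0 = legendreSym 3 n * LevelEightyFour.cFB.getD n 0 := by
  decide +kernel

/-- Row identity, chunk `n < 96` (kernel `decide`). [folklore] -/
theorem hrowTB_0 : ∀ n, 0 ≤ n → n < 96 → rowB.2.1 * tabTB.getD n 0 = ∑ j : Fin 37, rowB.2.2.getD (j : ℕ) 0 * (tabs j).getD n 0 := by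
  decide +kernel

/-- Row identity, chunk `96 ≤ n < 192` (kernel `decide`). [folklore] -/
theorem hrowTB_1 : ∀ n, 96 ≤ n → n < 192 → rowB.2.1 * tabTB.getD n 0 = ∑ j : Fin 37, rowB.2.2.getD (j : ℕ) 0 * (tabs j).getD n 0 := by
  decide +kernel

/-- **Row identity**: `d′·tabTB[n] = Σ_j y_j·tabs_j[n]`, `n < 192` — the kernel's pinned combination on this row IS the `χ₋₃`-twist of `φ₈₄ᵦ`
on the certified window. [folklore] -/
theorem hrowTB : ∀ n < 192, rowB.2.1 * tabTB.getD n 0 = ∑ j : Fin 37, rowB.2.2.getD (j : ℕ) 0 * (tabs j).getD n 0 := by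
  intro n hn
  by_cases h0 : n < 96
  · exact hrowTB_0 n (by omega) h0
  · exact hrowTB_1 n (by omega) hn

/-- **`aₙ(φ₈₄ᵦ ⊗ χ₋₃) = tabTB[n]`, `n < 192`**, read by the coefficient functionals of `S₂(Γ₀(252))`. [cite: Shimura1971, Prop. 3.64] -/
theorem tabTB_eq_cuspCoeff [Fact (Nat.Prime 3)] : ∀ n < 192, ((tabTB.getD n 0 : ℤ) : ℂ) = cuspCoeffₗ (one_mem_strictPeriods_coe_gamma0 252) n
    (charTwist 252 (⟨3, rfl⟩ : 84 ∣ 252) (⟨28, rfl⟩ : 3 ^ 2 ∣ 252) (isQuadratic_quadraticChar_ringHomComp 3) phiEightyFourB) := by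
  intro n hn
  have hc : ((tabTB.getD n 0 : ℤ) : ℂ) = ((legendreSym 3 n : ℤ) : ℂ) * ((LevelEightyFour.cFB.getD n 0 : ℤ) : ℂ) := by exact_mod_cast hTwB n hn
  rw [cuspCoeffₗ_apply, cuspCoeff_charTwist 252 _ _ (isQuadratic_quadraticChar_ringHomComp 3)
    (isPrimitive_quadraticChar_ringHomComp 3 (by norm_num)), quadraticChar_ringHomComp_apply_natCast, ← tB_eq_cuspCoeff n (by omega)]
  exact hc

/-- `goodCerts` is literally the list of the two rows (`252b` first). [folklore] -/
theorem goodCerts_eq : goodCerts = [rowB, rowA] := rfl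

/-- **LEVEL 252: THE ROWS.**  For every `X₀(252)`-datum `D` of an elliptic `W/ℚ`, the newform is the EXPLICIT twist `φ₈₄ᵦ ⊗ χ₋₃` (row `252b`,
`a₅ = −4`) or `φ₈₄ₐ ⊗ χ₋₃` (row `252a`, `a₅ = 0`) — no root datum, no modularity input. [cite: CremonaAlgorithms1997, Table 1 (N = 252)] [cite: Shimura1971, Prop. 3.64] -/
theorem f_cases [Fact (Nat.Prime 3)] (D : ModularParametrizationData W 252) :
    D.f = charTwist 252 (⟨3, rfl⟩ : 84 ∣ 252) (⟨28, rfl⟩ : 3 ^ 2 ∣ 252) (isQuadratic_quadraticChar_ringHomComp 3) phiEightyFourB ∨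
    D.f = charTwist 252 (⟨3, rfl⟩ : 84 ∣ 252) (⟨28, rfl⟩ : 3 ^ 2 ∣ 252) (isQuadratic_quadraticChar_ringHomComp 3) phiEightyFourA := by
  haveI : FiniteDimensional ℂ (CuspForm (Gamma0 252) 2) := finiteDimensional_cuspForm_gamma0 252 2
  obtain ⟨S, C, hCS, hC, c, hc, -, hpinS, -⟩ := pinning_cusp D
  have ht := tables_of_etaCertsSparse 252 192 (fun i : Fin 37 ↦ expFn (Ls[(i : ℕ)]).1) (fun i ↦ shifts i) tabs C hC hshift hcert
  have htS : ∀ i, ∀ n < 192, (((tabs i).getD n 0 : ℤ) : ℂ) = cuspCoeffₗ (one_mem_strictPeriods_coe_gamma0 252) n (S i) :=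
    fun i n hn ↦ by rw [cuspCoeffₗ_apply, ← modCoefₗ_modularForm (S i) n, hCS]; exact ht i n hn
  rw [goodCerts_eq] at hc
  simp only [List.mem_cons, List.mem_nil_iff, or_false] at hc
  rcases hc with rfl | rfl
  · exact Or.inl (eq_of_smul_eq_sum_of_row S tabs duals 1728 htS hlen hdual (by norm_num) finrank_cuspForm_two _
      tabTB tabTB_eq_cuspCoeff rowB.2.1 (by decide) rowB.2.2 hpinS hrowTB)
  · exact Or.inr (eq_of_smul_eq_sum_of_row S tabs duals 1728 htS hlen hdual (by norm_num) finrank_cuspForm_two _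
      tabTA tabTA_eq_cuspCoeff rowA.2.1 (by decide) rowA.2.2 hpinS hrowTA)

/-! ## §2 The root curves are multiplicative at `3` -/

/-- **`84b1 = [0, −1, 0, −1, −2]` has multiplicative reduction at `3`** (`3 ∣ Δ = −2352`, `3 ∤ c₄ = 64`; `84a1`: tree lemma `…Atlas002.mult_84a1`).
[cite: SilvermanAEC2009, VII.5 Prop. 5.1(b)] [cite: CremonaAlgorithms1997, Table 1 (84b1)] -/
theorem mult_84b1 : (⟨0, -1, 0, -1, -2⟩ : WeierstrassCurve ℚ).HasMultiplicativeReductionAtPrime 3 := by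
  haveI : Fact (Nat.Prime 3) := ⟨Nat.prime_three⟩
  haveI := AddPotGoodPrint.isElliptic_84b1
  haveI := AddPotGoodPrint.isGloballyMinimal_84b1
  exact hasMultiplicativeReductionAtPrime_of_intModel AddPotGoodPrint.intModel_84b1 3 (by rw [AddPotGoodPrint.M84b1_Δ]; decide)
    (by rw [AddPotGoodPrint.M84b1_c₄]; decide)

/-! ## §3 The headline -/

/-- **`|c| = 1` FOR EVERY LATTICE-OPTIMAL `X₀(252)`-DATUM of every globally minimal elliptic curve over `ℚ`** — UNCONDITIONAL.  Rows `D.f = φ₈₄ₓ ⊗ χ₋₃`,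
root squeezes `Λ(φ₈₄ₓ) ⊆ Λ_Néron(84x1)` (p2's level-84 Bracket–Sturm certificates, datum-free), roots multiplicative at `3`, p3's odd-twist root-form
transport at `p = 3`.  No root datum, no modularity, no CDT, no printed Manin fact.
[cite: Stevens1989, Lemma (5.2) p. 96, Lemma (5.4) p. 97] [cite: AgasheRibetStein2006, §§1–2] [cite: CremonaAlgorithms1997, Table 1 (N = 252)] -/
theorem abs_maninConstant_eq_one_twoFiftyTwo (W : WeierstrassCurve ℚ) [W.IsElliptic] [W.IsGloballyMinimal]
    (D : ModularParametrizationData W 252) (hopt : ∀ z ∈ D.L.lattice, ∃ w ∈ periodLattice D.f, z = D.c * w) :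
    |D.maninConstant| = 1 := by
  haveI h3 : Fact (Nat.Prime 3) := ⟨Nat.prime_three⟩
  rcases f_cases D with hf | hf
  · haveI := AddPotGoodPrint.isElliptic_84b1
    haveI := AddPotGoodPrint.isGloballyMinimal_84b1
    obtain ⟨L₀, h2, h3'⟩ := ((⟨0, -1, 0, -1, -2⟩ : WeierstrassCurve ℚ).baseChange ℂ).exists_periodPair_of_isElliptic'
    exact abs_maninConstant_eq_one_of_rootForm_charTwist_eq (p := 3) (by norm_num) (isQuadratic_quadraticChar_ringHomComp 3)
      (isPrimitive_quadraticChar_ringHomComp 3 (by norm_num)) phiEightyFourB (⟨0, -1, 0, -1, -2⟩ : WeierstrassCurve ℚ) L₀ ⟨h2, h3'⟩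
      (periodLattice_le_phiEightyFourB L₀ ⟨h2, h3'⟩) (Or.inr mult_84b1) W D _ _ hf hopt
  · haveI := AddPotGoodPrint.isElliptic_84a1
    haveI := AddPotGoodPrint.isGloballyMinimal_84a1
    obtain ⟨L₀, h2, h3'⟩ := ((⟨0, 1, 0, 7, 0⟩ : WeierstrassCurve ℚ).baseChange ℂ).exists_periodPair_of_isElliptic'
    exact abs_maninConstant_eq_one_of_rootForm_charTwist_eq (p := 3) (by norm_num) (isQuadratic_quadraticChar_ringHomComp 3)
      (isPrimitive_quadraticChar_ringHomComp 3 (by norm_num)) phiEightyFourA (⟨0, 1, 0, 7, 0⟩ : WeierstrassCurve ℚ) L₀ ⟨h2, h3'⟩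
      (periodLattice_le_phiEightyFourA L₀ ⟨h2, h3'⟩) (Or.inr EisensteinPrimesMazurMCOnCellBTwistbackShaUnitClassP3Atlas002.mult_84a1) W D _ _ hf hopt

/-- **C2 `ManinOddAtFour` at `N = 252` (`2² ∣ 252`): `2 ∤ c(D)`** for every lattice-optimal `X₀(252)`-datum — UNCONDITIONAL. [cite: AgasheRibetStein2006, §§1–2] -/
theorem not_two_dvd_maninConstant_twoFiftyTwo (W : WeierstrassCurve ℚ) [W.IsElliptic] [W.IsGloballyMinimal]
    (D : ModularParametrizationData W 252) (hopt : ∀ z ∈ D.L.lattice, ∃ w ∈ periodLattice D.f, z = D.c * w) :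
    ¬ (2 : ℤ) ∣ D.maninConstant := by
  have h := abs_maninConstant_eq_one_twoFiftyTwo W D hopt
  intro h2
  have := Int.le_of_dvd (by rw [h]; norm_num) ((dvd_abs _ _).mpr h2)
  rw [h] at this
  norm_num at this

/-- **C3 `ManinPrimeToThreeAtNine` at `N = 252` (`3² ∣ 252`): `3 ∤ c(D)`** for every lattice-optimal `X₀(252)`-datum — UNCONDITIONAL. [cite: AgasheRibetStein2006, §§1–2] -/
theorem not_three_dvd_maninConstant_twoFiftyTwo (W : WeierstrassCurve ℚ) [W.IsElliptic] [W.IsGloballyMinimal]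
    (D : ModularParametrizationData W 252) (hopt : ∀ z ∈ D.L.lattice, ∃ w ∈ periodLattice D.f, z = D.c * w) :
    ¬ (3 : ℤ) ∣ D.maninConstant := by
  have h := abs_maninConstant_eq_one_twoFiftyTwo W D hopt
  intro h3
  have := Int.le_of_dvd (by rw [h]; norm_num) ((dvd_abs _ _).mpr h3)
  rw [h] at this
  norm_num at this

/-- **The C2 conclusion on the whole `X₀(252)`-domain**: `2² ∣ 252`, and `|c| = 1 ∧ 2 ∤ c` for every lattice-optimal `X₀(252)`-datum — UNCONDITIONAL;
BSD and C2 for general `N` are NOT proved by this. [folklore] -/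
theorem maninOddAtFour_twoFiftyTwo :
    2 ^ 2 ∣ 252 ∧ ∀ (W : WeierstrassCurve ℚ) [W.IsElliptic] [W.IsGloballyMinimal] (D : ModularParametrizationData W 252),
      (∀ z ∈ D.L.lattice, ∃ w ∈ periodLattice D.f, z = D.c * w) → |D.maninConstant| = 1 ∧ ¬ (2 : ℤ) ∣ D.maninConstant :=
  ⟨⟨63, by norm_num⟩, fun W _ _ D hopt ↦ ⟨abs_maninConstant_eq_one_twoFiftyTwo W D hopt, not_two_dvd_maninConstant_twoFiftyTwo W D hopt⟩⟩

/-- **The C3 conclusion on the whole `X₀(252)`-domain**: `3² ∣ 252`, and `|c| = 1 ∧ 3 ∤ c` for every lattice-optimal `X₀(252)`-datum — UNCONDITIONAL;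
BSD and C3 for general `N` are NOT proved by this. [folklore] -/
theorem maninPrimeToThreeAtNine_twoFiftyTwo :
    3 ^ 2 ∣ 252 ∧ ∀ (W : WeierstrassCurve ℚ) [W.IsElliptic] [W.IsGloballyMinimal] (D : ModularParametrizationData W 252),
      (∀ z ∈ D.L.lattice, ∃ w ∈ periodLattice D.f, z = D.c * w) → |D.maninConstant| = 1 ∧ ¬ (3 : ℤ) ∣ D.maninConstant :=
  ⟨⟨28, by norm_num⟩, fun W _ _ D hopt ↦ ⟨abs_maninConstant_eq_one_twoFiftyTwo W D hopt, not_three_dvd_maninConstant_twoFiftyTwo W D hopt⟩⟩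

end Summit.BirchSwinnertonDyer.BirchSwinnertonDyer.Theorems.ManinLocalTwoThree.LevelTwoFiftyTwo

end
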